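import Summits.QuantumAdvantage.QuantumAdvantage.Theorems.SosSandwichPseudoBoundedAAClassicalCorner
import HarnessLib

/-!
# Crux `PseudoBoundedAA` (stmt-QuantumAdvantage-15237, route SosSandwich) — the classical corner in EXPECTED-COST form:
# `16·Var[p]² ≤ Q̄²·maxᵢ Infᵢ[p]`, `Q̄` = expected number of queries on a uniformly random input

File 6 of the CLASSICAL CORNER of PB-AA.  Files 1–5 bound the variance of the acceptance probability of a randomized
classical algorithm through the (average) WORST-CASE depth `D̄ = Σ_k w_k·depth(t_k)`.  The O'Donnell–Saks–Schramm–Servedio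
inequality is really about `δ_i = Pr[variable i is queried]`, whose sum is the EXPECTED number of queries.  This file proves
the tree's two-function OSSS inequality (`BooleanCorner.osss_depth`, H. K. Lee's induction relative to a partial assignment)
in COST form and derives the sharper corner:

* `osss_cost_aux`, `osss_cost` — for the `0/1` output `F` of a decision tree `T` and any real `g` with `L¹` increments
  `≤ M`: `2^N Σ F g − (Σ F)(Σ g) ≤ (Σₓ cost_T(x)) · M / 4`, i.e. `Cov[F, g] ≤ E_x[cost_T(x)] · maxⱼ E|g(x^{j→1}) − g(x^{j→0})|/4`
  (`DecisionTree.cost` = number of queries on input `x`, repeated queries counted; the induction is an EQUALITY bookkeeping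
  of costs at a fresh root: `Σ cost_T = 2^N + (Σ cost_{t₁} + Σ cost_{t₀})/2`);
* `osss_mixture_cost` — the same for finite mixtures `P = Σ_k w_k·[t_k accepts]`, bound `(Σ_k w_k Σₓ cost_{t_k}(x))·M/4`;
* **`exists_influence_ge_of_mixture_avgCost`** — if `p` is on the cube a finite mixture of decision trees and `Var[p] > 0`,
  then `Var[p] ≤ Q̄·√(maxⱼ Infⱼ[p])/4` with `Q̄ := Σ_k w_k · E_x[cost_{t_k}(x)]` the expected number of queries of the
  randomized algorithm on a UNIFORMLY RANDOM input (internal randomness and input both averaged);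
  `exists_influence_ge_of_mixture_avgCost_sq` — `16·Var[p]² ≤ Q̄²·Infⱼ[p]`.  Since `Q̄ ≤ D̄ ≤ max depth`, this refines
  files 1–2 (e.g. for algorithms that stop early on most inputs).

Honest label: a sharper corner lemma (OSSS in expected-cost form); no stub, crux or summit is closed.  Sources: O'Donnell–
Saks–Schramm–Servedio, FOCS 2005, Thm 3.2 (`Σ_i δ_i = E[# queries]`); H. K. Lee, *Decision trees and influence: an
inductive proof of the OSSS inequality*, Theory of Computing 6 (2010) 81–84; Aaronson–Ambainis arXiv:0911.0996 Conj. 6.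
-/

set_option linter.dupNamespace false

noncomputable section

namespace Summit.QuantumAdvantage.QuantumAdvantage.Theorems.SosSandwich

open Finset Function
open Literature.Computability.Complexity Literature.Computability.QuantumComplexity

namespace ClassicalCorner

variable {N : ℕ}

/-! ### OSSS in expected-cost form, by Lee's induction relative to a partial assignment -/

/-- **OSSS, two-function EXPECTED-COST form, relative to a partial assignment.** For a decision tree `T` run on inputs
overridden by a partial assignment `ρ` (`x ↦ (k ↦ (ρ k).getD (x k))`), with `0/1` output `F`, and any real `g` whose `L¹`
increments are all `≤ M`: `2^N Σ F·g − (Σ F)(Σ g) ≤ (Σₓ cost_T(x̄)) · M / 4`, where `cost_T(x̄)` is the number of queries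
`T` makes on the overridden input.  Induction on `T` (Lee): at a fresh root variable `i`,
`Cov[F,g] = ½Cov[F₀,Γ] + ½Cov[F₁,Γ] + E[(F₁−F₀)(g₁−g₀)]/4` and `Σ cost_T = 2^N + (Σ cost_{t₁}[i↦1] + Σ cost_{t₀}[i↦0])/2`;
at an already-assigned root the tree behaves as one subtree and costs one more query.
[cite: OdonnellEtAl2005, Thm 3.2] [cite: Lee2010, Thm 1 (inductive proof)] -/
theorem osss_cost_aux (T : DecisionTree N) :
    ∀ (ρ : Fin N → Option Bool) (F g : (Fin N → Bool) → ℝ) (M : ℝ),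
      (∀ x, F x = if T.eval (fun k => (ρ k).getD (x k)) = true then (1 : ℝ) else 0) → 0 ≤ M →
      (∀ j : Fin N, ∑ x, |g (update x j true) - g (update x j false)| ≤ M) →
      (2 : ℝ) ^ N * (∑ x, F x * g x) - (∑ x, F x) * (∑ x, g x)
        ≤ (∑ x : Fin N → Bool, (T.cost (fun k => (ρ k).getD (x k)) : ℝ)) * M / 4 := by
  induction T with
  | leaf c =>
    intro ρ F g M hF hM hg
    have hc : ∀ x : Fin N → Bool, F x = (if c = true then (1 : ℝ) else 0) := fun x => by
      rw [hF x]; simp [DecisionTree.eval]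
    have h1 : ∑ x, F x * g x = (if c = true then (1 : ℝ) else 0) * ∑ x, g x := by
      rw [Finset.mul_sum]; exact Finset.sum_congr rfl fun x _ => by rw [hc x]
    have h2 : ∑ x, F x = (2 : ℝ) ^ N * (if c = true then (1 : ℝ) else 0) := by
      rw [Finset.sum_congr rfl fun x _ => hc x, Finset.sum_const, Finset.card_univ, BooleanCorner.card_cube_nat,
        nsmul_eq_mul]
      push_cast; ring
    rw [h1, h2]
    simp [DecisionTree.cost]
  | query i t₀ t₁ ih₀ ih₁ =>
    intro ρ F g M hF hM hg
    have h2N : (0 : ℝ) ≤ (2 : ℝ) ^ N := by positivity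
    rcases hρ : ρ i with _ | b
    · /- fresh query: split along `x i` -/
      set F₀ : (Fin N → Bool) → ℝ :=
        fun x => if t₀.eval (fun k => ((update ρ i (some false)) k).getD (x k)) = true then (1 : ℝ) else 0 with hF₀
      set F₁ : (Fin N → Bool) → ℝ :=
        fun x => if t₁.eval (fun k => ((update ρ i (some true)) k).getD (x k)) = true then (1 : ℝ) else 0 with hF₁
      set C₀ : (Fin N → Bool) → ℝ :=
        fun x => (t₀.cost (fun k => ((update ρ i (some false)) k).getD (x k)) : ℝ) with hC₀
      set C₁ : (Fin N → Bool) → ℝ :=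
        fun x => (t₁.cost (fun k => ((update ρ i (some true)) k).getD (x k)) : ℝ) with hC₁
      set g₀ : (Fin N → Bool) → ℝ := fun x => g (update x i false) with hg₀
      set g₁ : (Fin N → Bool) → ℝ := fun x => g (update x i true) with hg₁
      set Γ : (Fin N → Bool) → ℝ := fun x => (g₀ x + g₁ x) / 2 with hΓ
      -- overriding by `ρ[i ↦ b]` ignores `x i`
      have hov : ∀ (b c : Bool) (x : Fin N → Bool),
          (fun k => ((update ρ i (some b)) k).getD ((update x i c) k))
            = fun k => ((update ρ i (some b)) k).getD (x k) := by
        intro b c x; funext k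
        by_cases hk : k = i
        · subst hk; simp
        · simp [hk]
      have hF₀u : ∀ x c, F₀ (update x i c) = F₀ x := fun x c => by simp only [hF₀, hov]
      have hF₁u : ∀ x c, F₁ (update x i c) = F₁ x := fun x c => by simp only [hF₁, hov]
      have hC₀u : ∀ x c, C₀ (update x i c) = C₀ x := fun x c => by simp only [hC₀, hov]
      have hC₁u : ∀ x c, C₁ (update x i c) = C₁ x := fun x c => by simp only [hC₁, hov]
      have hg₀u : ∀ x c, g₀ (update x i c) = g₀ x := fun x c => by simp [hg₀]
      have hg₁u : ∀ x c, g₁ (update x i c) = g₁ x := fun x c => by simp [hg₁]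
      -- on the branch `x i = b` the override by `ρ` is the override by `ρ[i ↦ b]`
      have hovb : ∀ (x : Fin N → Bool),
          (fun k => (ρ k).getD (x k)) = fun k => ((update ρ i (some (x i))) k).getD (x k) := by
        intro x; funext k
        by_cases hk : k = i
        · subst hk; simp [hρ]
        · simp [hk]
      have hxi : ∀ x : Fin N → Bool, (ρ i).getD (x i) = x i := fun x => by simp [hρ]
      have hFx : ∀ x : Fin N → Bool, F x = if x i = true then F₁ x else F₀ x := by
        intro x
        rw [hF x, DecisionTree.eval_query]
        simp only [hxi x]
        rcases Bool.eq_false_or_eq_true (x i) with hx | hx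
        · rw [if_pos hx, if_pos hx, hF₁]
          simp only
          rw [hovb x, hx]
        · have hx' : ¬ (x i = true) := by rw [hx]; decide
          rw [if_neg hx', if_neg hx', hF₀]
          simp only
          rw [hovb x, hx]
      have hCx : ∀ x : Fin N → Bool,
          ((DecisionTree.query i t₀ t₁).cost (fun k => (ρ k).getD (x k)) : ℝ)
            = (if x i = true then C₁ x else C₀ x) + 1 := by
        intro x
        rw [DecisionTree.cost_query]
        simp only [hxi x]
        rcases Bool.eq_false_or_eq_true (x i) with hx | hx
        · rw [if_pos hx, if_pos hx, hC₁]
          simp only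
          rw [hovb x, hx]
          push_cast; ring
        · have hx' : ¬ (x i = true) := by rw [hx]; decide
          rw [if_neg hx', if_neg hx', hC₀]
          simp only
          rw [hovb x, hx]
          push_cast; ring
      have hgs : ∀ x : Fin N → Bool, g x = if x i = true then g₁ x else g₀ x := by
        intro x
        rcases Bool.eq_false_or_eq_true (x i) with hx | hx
        · rw [if_pos hx, hg₁]; simp only; rw [← hx, update_eq_self]
        · have hx' : ¬ (x i = true) := by rw [hx]; decide
          rw [if_neg hx', hg₀]; simp only; rw [← hx, update_eq_self]
      -- the sums
      have hSfg : ∑ x, F x * g x = ((∑ x, F₁ x * g₁ x) + ∑ x, F₀ x * g₀ x) / 2 := by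
        have : ∀ x, F x * g x = if x i = true then F₁ x * g₁ x else F₀ x * g₀ x := by
          intro x; rw [hFx x]
          rcases Bool.eq_false_or_eq_true (x i) with hx | hx
          · rw [if_pos hx, if_pos hx, hgs x, if_pos hx]
          · have hx' : ¬ (x i = true) := by rw [hx]; decide
            rw [if_neg hx', if_neg hx', hgs x, if_neg hx']
        rw [Finset.sum_congr rfl fun x _ => this x]
        exact BooleanCorner.sum_ite_update i _ _ (fun x c => by rw [hF₁u, hg₁u]) (fun x c => by rw [hF₀u, hg₀u])
      have hSf : ∑ x, F x = ((∑ x, F₁ x) + ∑ x, F₀ x) / 2 := by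
        rw [Finset.sum_congr rfl fun x _ => hFx x]
        exact BooleanCorner.sum_ite_update i _ _ hF₁u hF₀u
      have hSg : ∑ x, g x = ((∑ x, g₁ x) + ∑ x, g₀ x) / 2 := by
        conv_lhs => rw [Finset.sum_congr rfl fun x (_ : x ∈ Finset.univ) => hgs x]
        exact BooleanCorner.sum_ite_update i _ _ hg₁u hg₀u
      have hSC : ∑ x : Fin N → Bool, ((DecisionTree.query i t₀ t₁).cost (fun k => (ρ k).getD (x k)) : ℝ)
          = ((∑ x, C₁ x) + ∑ x, C₀ x) / 2 + (2 : ℝ) ^ N := by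
        rw [Finset.sum_congr rfl fun x _ => hCx x, Finset.sum_add_distrib,
          BooleanCorner.sum_ite_update i _ _ hC₁u hC₀u, Finset.sum_const, Finset.card_univ,
          BooleanCorner.card_cube_nat, nsmul_eq_mul]
        push_cast; ring
      -- induction hypotheses on the sections, against `Γ`
      have hΓ_incr : ∀ j : Fin N, ∑ x, |Γ (update x j true) - Γ (update x j false)| ≤ M := by
        intro j
        refine le_trans ?_ (hg j)
        simp only [hΓ, hg₀, hg₁]
        exact BooleanCorner.sum_abs_sections_le i j g
      have IH₀ : (2 : ℝ) ^ N * (∑ x, F₀ x * Γ x) - (∑ x, F₀ x) * (∑ x, Γ x) ≤ (∑ x, C₀ x) * M / 4 :=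
        ih₀ (update ρ i (some false)) F₀ Γ M (fun x => rfl) hM hΓ_incr
      have IH₁ : (2 : ℝ) ^ N * (∑ x, F₁ x * Γ x) - (∑ x, F₁ x) * (∑ x, Γ x) ≤ (∑ x, C₁ x) * M / 4 :=
        ih₁ (update ρ i (some true)) F₁ Γ M (fun x => rfl) hM hΓ_incr
      have hΓ₀ : ∑ x, F₀ x * Γ x = ((∑ x, F₀ x * g₀ x) + ∑ x, F₀ x * g₁ x) / 2 := by
        rw [← Finset.sum_add_distrib, Finset.sum_div]
        exact Finset.sum_congr rfl fun x _ => by simp only [hΓ]; ring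
      have hΓ₁ : ∑ x, F₁ x * Γ x = ((∑ x, F₁ x * g₀ x) + ∑ x, F₁ x * g₁ x) / 2 := by
        rw [← Finset.sum_add_distrib, Finset.sum_div]
        exact Finset.sum_congr rfl fun x _ => by simp only [hΓ]; ring
      have hΓs : ∑ x, Γ x = ((∑ x, g₀ x) + ∑ x, g₁ x) / 2 := by
        rw [← Finset.sum_add_distrib, Finset.sum_div]
      rw [hΓ₀, hΓs] at IH₀
      rw [hΓ₁, hΓs] at IH₁
      -- the cross term `Σ (F₁ − F₀)(g₁ − g₀) ≤ Σ |g₁ − g₀| ≤ M`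
      have hF01 : ∀ x, |F₁ x - F₀ x| ≤ 1 := by
        intro x; simp only [hF₁, hF₀]; split_ifs <;> norm_num
      have hcross : (∑ x, F₁ x * g₁ x) - (∑ x, F₁ x * g₀ x) - (∑ x, F₀ x * g₁ x) + ∑ x, F₀ x * g₀ x ≤ M := by
        have h1 : (∑ x, F₁ x * g₁ x) - (∑ x, F₁ x * g₀ x) - (∑ x, F₀ x * g₁ x) + ∑ x, F₀ x * g₀ x
            = ∑ x, (F₁ x - F₀ x) * (g₁ x - g₀ x) := by
          rw [← Finset.sum_sub_distrib, ← Finset.sum_sub_distrib, ← Finset.sum_add_distrib]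
          exact Finset.sum_congr rfl fun x _ => by ring
        rw [h1]
        calc ∑ x, (F₁ x - F₀ x) * (g₁ x - g₀ x) ≤ ∑ x, |g₁ x - g₀ x| := by
              refine Finset.sum_le_sum fun x _ => ?_
              calc (F₁ x - F₀ x) * (g₁ x - g₀ x) ≤ |(F₁ x - F₀ x) * (g₁ x - g₀ x)| := le_abs_self _
                _ = |F₁ x - F₀ x| * |g₁ x - g₀ x| := abs_mul _ _
                _ ≤ 1 * |g₁ x - g₀ x| := mul_le_mul_of_nonneg_right (hF01 x) (abs_nonneg _)
                _ = |g₁ x - g₀ x| := one_mul _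
          _ ≤ M := by simpa only [hg₁, hg₀] using hg i
      rw [hSfg, hSf, hSg, hSC]
      nlinarith [IH₀, IH₁, hcross, mul_nonneg h2N hM]
    · /- the root variable is already assigned by `ρ`: the tree behaves as the `b`-subtree and costs one more query -/
      have hxi : ∀ x : Fin N → Bool, (ρ i).getD (x i) = b := fun x => by simp [hρ]
      have hcq : ∀ (t : DecisionTree N),
          (∀ x : Fin N → Bool, (t.cost (fun k => (ρ k).getD (x k)) : ℝ)
            ≤ ((DecisionTree.query i t₀ t₁).cost (fun k => (ρ k).getD (x k)) : ℝ)) →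
          (∑ x : Fin N → Bool, (t.cost (fun k => (ρ k).getD (x k)) : ℝ)) * M / 4
            ≤ (∑ x : Fin N → Bool, ((DecisionTree.query i t₀ t₁).cost (fun k => (ρ k).getD (x k)) : ℝ)) * M / 4 := by
        intro t ht
        have hs := Finset.sum_le_sum fun x (_ : x ∈ (Finset.univ : Finset (Fin N → Bool))) => ht x
        have hM4 : (0 : ℝ) ≤ M / 4 := by positivity
        have := mul_le_mul_of_nonneg_right hs hM4
        simpa [mul_div_assoc] using this
      cases b with
      | false =>
        have hF' : ∀ x, F x = if t₀.eval (fun k => (ρ k).getD (x k)) = true then (1 : ℝ) else 0 := by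
          intro x; rw [hF x, DecisionTree.eval_query]; simp only [hxi x]; rfl
        refine (ih₀ ρ F g M hF' hM hg).trans (hcq t₀ fun x => ?_)
        rw [DecisionTree.cost_query]
        simp only [hxi x]
        push_cast
        simp
      | true =>
        have hF' : ∀ x, F x = if t₁.eval (fun k => (ρ k).getD (x k)) = true then (1 : ℝ) else 0 := by
          intro x; rw [hF x, DecisionTree.eval_query]; simp only [hxi x]; rfl
        refine (ih₁ ρ F g M hF' hM hg).trans (hcq t₁ fun x => ?_)
        rw [DecisionTree.cost_query]
        simp only [hxi x]
        push_cast
        simp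

/-- **OSSS, two-function EXPECTED-COST form** for the tree's Boolean decision trees: with `F` the `0/1` output of `T` and
every `L¹` increment of `g` at most `M`, `2^N Σ F·g − (Σ F)(Σ g) ≤ (Σₓ cost_T(x)) · M / 4`, i.e.
`Cov[F, g] ≤ E_x[cost_T(x)] · maxⱼ E|g(x^{j→1}) − g(x^{j→0})| / 4` — the standard `Σᵢ δᵢ` form up to counting repeated
queries. [cite: OdonnellEtAl2005, Thm 3.2] [cite: Lee2010, Thm 1] -/
theorem osss_cost (T : DecisionTree N) (F g : (Fin N → Bool) → ℝ) (M : ℝ)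
    (hF : ∀ x, F x = if T.eval x = true then (1 : ℝ) else 0) (hM : 0 ≤ M)
    (hg : ∀ j : Fin N, ∑ x, |g (update x j true) - g (update x j false)| ≤ M) :
    (2 : ℝ) ^ N * (∑ x, F x * g x) - (∑ x, F x) * (∑ x, g x) ≤ (∑ x, (T.cost x : ℝ)) * M / 4 :=
  osss_cost_aux T (fun _ => none) F g M (fun x => by rw [hF x]; rfl) hM hg

/-! ### Mixtures: the classical corner with the expected number of queries -/

/-- **Two-function OSSS for mixtures, expected-cost form.** If `P(x) = Σ_{k∈s} w_k·[t_k accepts x]` with `w_k ≥ 0` and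
`g` has all `L¹` increments `≤ M`, then `2^N Σ P g − (Σ P)(Σ g) ≤ (Σ_k w_k·Σₓ cost_{t_k}(x)) · M / 4`.
[cite: OdonnellEtAl2005, Thm 3.2] -/
theorem osss_mixture_cost {ι : Type*} (s : Finset ι) (w : ι → ℝ) (hw : ∀ k ∈ s, 0 ≤ w k)
    (t : ι → DecisionTree N) (P g : (Fin N → Bool) → ℝ)
    (hP : ∀ x, P x = ∑ k ∈ s, w k * (if (t k).eval x = true then (1 : ℝ) else 0))
    (M : ℝ) (hM : 0 ≤ M) (hg : ∀ j : Fin N, ∑ x, |g (update x j true) - g (update x j false)| ≤ M) :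
    (2 : ℝ) ^ N * (∑ x, P x * g x) - (∑ x, P x) * (∑ x, g x)
      ≤ (∑ k ∈ s, w k * ∑ x, ((t k).cost x : ℝ)) * M / 4 := by
  set F : ι → (Fin N → Bool) → ℝ := fun k x => if (t k).eval x = true then (1 : ℝ) else 0 with hF
  have hPg : ∑ x, P x * g x = ∑ k ∈ s, w k * ∑ x, F k x * g x := by
    calc ∑ x, P x * g x = ∑ x, ∑ k ∈ s, w k * (F k x * g x) := by
          refine Finset.sum_congr rfl fun x _ => ?_
          rw [hP x, Finset.sum_mul]
          exact Finset.sum_congr rfl fun k _ => by ring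
      _ = ∑ k ∈ s, ∑ x, w k * (F k x * g x) := Finset.sum_comm
      _ = ∑ k ∈ s, w k * ∑ x, F k x * g x :=
          Finset.sum_congr rfl fun k _ => by rw [Finset.mul_sum]
  have hPs : ∑ x, P x = ∑ k ∈ s, w k * ∑ x, F k x := by
    calc ∑ x, P x = ∑ x, ∑ k ∈ s, w k * F k x := Finset.sum_congr rfl fun x _ => hP x
      _ = ∑ k ∈ s, ∑ x, w k * F k x := Finset.sum_comm
      _ = ∑ k ∈ s, w k * ∑ x, F k x := Finset.sum_congr rfl fun k _ => by rw [Finset.mul_sum]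
  have hlin : (2 : ℝ) ^ N * (∑ x, P x * g x) - (∑ x, P x) * (∑ x, g x)
      = ∑ k ∈ s, w k * ((2 : ℝ) ^ N * (∑ x, F k x * g x) - (∑ x, F k x) * (∑ x, g x)) := by
    rw [hPg, hPs, Finset.mul_sum, Finset.sum_mul, ← Finset.sum_sub_distrib]
    exact Finset.sum_congr rfl fun k _ => by ring
  rw [hlin]
  have hrhs : (∑ k ∈ s, w k * ∑ x, ((t k).cost x : ℝ)) * M / 4
      = ∑ k ∈ s, w k * ((∑ x, ((t k).cost x : ℝ)) * M / 4) := by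
    rw [Finset.sum_mul, Finset.sum_div]
    exact Finset.sum_congr rfl fun k _ => by ring
  rw [hrhs]
  refine Finset.sum_le_sum fun k hk => ?_
  exact mul_le_mul_of_nonneg_left (osss_cost (t k) (F k) g M (fun x => rfl) hM hg) (hw k hk)

/-- **The classical corner in expected-cost form.** If the real polynomial `p` takes on the cube the values of a finite
mixture of decision trees (`w_k ≥ 0`) and `Var[p] > 0`, then for the variable `j` of largest influence
`Var[p] ≤ Q̄ · √Infⱼ[p] / 4`, where `Q̄ = Σ_k w_k · E_x[cost_{t_k}(x)]` is the expected number of queries of the randomized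
algorithm on a uniformly random input. [cite: OdonnellEtAl2005, Thm 3.2] [cite: AaronsonAmbainis2014, Conj. 6] -/
theorem exists_influence_ge_of_mixture_avgCost {ι : Type*} (s : Finset ι) (w : ι → ℝ) (hw : ∀ k ∈ s, 0 ≤ w k)
    (t : ι → DecisionTree N) (p : MvPolynomial (Fin N) ℝ)
    (hp : ∀ x, evalBool p x = ∑ k ∈ s, w k * (if (t k).eval x = true then (1 : ℝ) else 0))
    (hv : 0 < boolVariance p) :
    ∃ j : Fin N, boolVariance p ≤
      (∑ k ∈ s, w k * ((∑ x, ((t k).cost x : ℝ)) / (2 : ℝ) ^ N)) * Real.sqrt (influence j p) / 4 := by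
  classical
  rcases Nat.eq_zero_or_pos N with hN0 | hNpos
  · subst hN0
    exact absurd (BooleanCorner.boolVariance_fin_zero p) (ne_of_gt hv)
  have hne : (Finset.univ : Finset (Fin N)).Nonempty := ⟨⟨0, hNpos⟩, Finset.mem_univ _⟩
  obtain ⟨j, -, hj⟩ := Finset.exists_max_image Finset.univ (fun j => influence j p) hne
  refine ⟨j, ?_⟩
  have h2N : (0 : ℝ) < (2 : ℝ) ^ N := by positivity
  have hMj : ∀ j' : Fin N, ∑ x, |evalBool p (update x j' true) - evalBool p (update x j' false)|
      ≤ (2 : ℝ) ^ N * Real.sqrt (influence j p) := fun j' =>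
    (sum_abs_update_le_sqrt_influence p j').trans
      (mul_le_mul_of_nonneg_left (Real.sqrt_le_sqrt (hj j' (Finset.mem_univ _))) h2N.le)
  have key := osss_mixture_cost s w hw t (evalBool p) (evalBool p) hp
    ((2 : ℝ) ^ N * Real.sqrt (influence j p)) (by positivity) hMj
  rw [BooleanCorner.sum_sq_sub_sq_sum_eq] at key
  -- `Σ_k w_k Σ_x cost = 2^N · Q̄`
  have hQ : ∑ k ∈ s, w k * ∑ x, ((t k).cost x : ℝ)
      = (2 : ℝ) ^ N * ∑ k ∈ s, w k * ((∑ x, ((t k).cost x : ℝ)) / (2 : ℝ) ^ N) := by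
    rw [Finset.mul_sum]
    exact Finset.sum_congr rfl fun k _ => by field_simp
  rw [hQ] at key
  have key' : (2 : ℝ) ^ N * ((2 : ℝ) ^ N * boolVariance p)
      ≤ (2 : ℝ) ^ N * ((2 : ℝ) ^ N * ((∑ k ∈ s, w k * ((∑ x, ((t k).cost x : ℝ)) / (2 : ℝ) ^ N))
          * Real.sqrt (influence j p) / 4)) := by
    calc (2 : ℝ) ^ N * ((2 : ℝ) ^ N * boolVariance p)
        ≤ (2 : ℝ) ^ N * (∑ k ∈ s, w k * ((∑ x, ((t k).cost x : ℝ)) / (2 : ℝ) ^ N))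
            * ((2 : ℝ) ^ N * Real.sqrt (influence j p)) / 4 := key
      _ = _ := by ring
  exact le_of_mul_le_mul_left (le_of_mul_le_mul_left key' h2N) h2N

/-- Squared form: `16·Var[p]² ≤ Q̄²·Infⱼ[p]` with `Q̄` the expected number of queries on a uniformly random input.
[cite: OdonnellEtAl2005, Thm 3.2] -/
theorem exists_influence_ge_of_mixture_avgCost_sq {ι : Type*} (s : Finset ι) (w : ι → ℝ)
    (hw : ∀ k ∈ s, 0 ≤ w k) (t : ι → DecisionTree N) (p : MvPolynomial (Fin N) ℝ)
    (hp : ∀ x, evalBool p x = ∑ k ∈ s, w k * (if (t k).eval x = true then (1 : ℝ) else 0))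
    (hv : 0 < boolVariance p) :
    ∃ j : Fin N, 16 * boolVariance p ^ 2 ≤
      (∑ k ∈ s, w k * ((∑ x, ((t k).cost x : ℝ)) / (2 : ℝ) ^ N)) ^ 2 * influence j p := by
  obtain ⟨j, hj⟩ := exists_influence_ge_of_mixture_avgCost s w hw t p hp hv
  refine ⟨j, ?_⟩
  have hI := influence_nonneg j p
  have h4 : 4 * boolVariance p
      ≤ (∑ k ∈ s, w k * ((∑ x, ((t k).cost x : ℝ)) / (2 : ℝ) ^ N)) * Real.sqrt (influence j p) := by
    linarith
  calc 16 * boolVariance p ^ 2 = (4 * boolVariance p) ^ 2 := by ring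
    _ ≤ ((∑ k ∈ s, w k * ((∑ x, ((t k).cost x : ℝ)) / (2 : ℝ) ^ N)) * Real.sqrt (influence j p)) ^ 2 :=
        pow_le_pow_left₀ (by linarith) h4 2
    _ = (∑ k ∈ s, w k * ((∑ x, ((t k).cost x : ℝ)) / (2 : ℝ) ^ N)) ^ 2 * influence j p := by
        rw [mul_pow, Real.sq_sqrt hI]

/-- The expected-cost bound refines the depth bound: `Q̄ ≤ D̄` since `cost_t(x) ≤ depth(t)` pointwise
(`DecisionTree.cost_le_depth`). [cite: Wolf2002, §2.1] -/
theorem avgCost_le_avgDepth {ι : Type*} (s : Finset ι) (w : ι → ℝ) (hw : ∀ k ∈ s, 0 ≤ w k)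
    (t : ι → DecisionTree N) :
    ∑ k ∈ s, w k * ((∑ x : Fin N → Bool, ((t k).cost x : ℝ)) / (2 : ℝ) ^ N)
      ≤ ∑ k ∈ s, w k * ((t k).depth : ℝ) := by
  refine Finset.sum_le_sum fun k hk => mul_le_mul_of_nonneg_left ?_ (hw k hk)
  have h2N : (0 : ℝ) < (2 : ℝ) ^ N := by positivity
  rw [div_le_iff₀ h2N]
  calc ∑ x : Fin N → Bool, ((t k).cost x : ℝ) ≤ ∑ _x : Fin N → Bool, ((t k).depth : ℝ) :=
        Finset.sum_le_sum fun x _ => by exact_mod_cast DecisionTree.cost_le_depth (t k) x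
    _ = ((t k).depth : ℝ) * (2 : ℝ) ^ N := by
        rw [Finset.sum_const, Finset.card_univ, BooleanCorner.card_cube_nat, nsmul_eq_mul]
        push_cast; ring

end ClassicalCorner

end Summit.QuantumAdvantage.QuantumAdvantage.Theorems.SosSandwich

end
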